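import Literature.NumberTheory.Automorphic.QuaternionAlgebraStructure
import Literature.NumberTheory.Automorphic.QuaternionAlgebraSplitting
import HarnessLib

/-!
# Integral models `ℍ[K,a,b]`, `a, b ∈ 𝓞 K`, of quaternion algebras over number fields

Topic `NumberTheory/Automorphic`; theorems only (no definition, no named fact, no instance).
Rescaling the generators `i ↦ c i`, `j ↦ d j` identifies `ℍ[K,a,b]` with `ℍ[K, a c², b d²]`
(`QuaternionAlgebra.nonempty_algEquiv_of_eq_mul_sq`); clearing denominators, every quaternion
algebra over a number field `K` is `K`-isomorphic to some `ℍ[K,a,b]` with `a, b ∈ 𝓞 K ∖ 0`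
(`exists_algEquiv_quaternionAlgebra_integers`; Vignéras, LNM 800, Ch. I §1, "on peut supposer
`a, b` entiers"). This puts an abstract quaternion algebra in the coordinates used by the tree's
adelic/strong-approximation files (`QuaternionCoordOrder*.lean`).

## References

* M.-F. Vignéras, *Arithmétique des algèbres de quaternions*, LNM 800 (1980), Ch. I §1
  [VignerasLNM800].
-/

open NumberField
open scoped Quaternion

namespace Literature.NumberTheory.Automorphic

namespace QuaternionAlgebra

/-- **Rescaling the generators**: `ℍ[K,a,b] ≃ₐ[K] ℍ[K, a c², b d²]` for `c d ≠ 0` (the basis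
`c⁻¹ i', d⁻¹ j'` of the target satisfies the relations of `ℍ[K,a,b]`; the induced algebra map is
injective since `ℍ[K,a,b]` is simple, hence bijective by dimension). [cite: VignerasLNM800, Ch. I §1] -/
theorem nonempty_algEquiv_of_eq_mul_sq {K : Type*} [Field K] [NeZero (2 : K)] {a b a₂ b₂ c d : K}
    (ha : a ≠ 0) (hb : b ≠ 0) (hc : c ≠ 0) (hd : d ≠ 0) (h₁ : a₂ = a * c ^ 2)
    (h₂ : b₂ = b * d ^ 2) : Nonempty (ℍ[K,a,b] ≃ₐ[K] ℍ[K,a₂,b₂]) := by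
  subst h₁ h₂
  let q : _root_.QuaternionAlgebra.Basis ℍ[K,a * c ^ 2,b * d ^ 2] a 0 b :=
    { i := ⟨0, c⁻¹, 0, 0⟩
      j := ⟨0, 0, d⁻¹, 0⟩
      k := ⟨0, 0, 0, c⁻¹ * d⁻¹⟩
      i_mul_i := by ext <;> (simp; try field_simp)
      j_mul_j := by ext <;> (simp; try field_simp)
      i_mul_j := by ext <;> simp
      j_mul_i := by ext <;> simp; ring }
  let φ : ℍ[K,a,b] →ₐ[K] ℍ[K,a * c ^ 2,b * d ^ 2] := q.liftHom
  haveI := QuaternionAlgebra.isSimpleRing ha hb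
  have hinj : Function.Injective φ := RingHom.injective φ.toRingHom
  have hdim : Module.finrank K ℍ[K,a,b] = Module.finrank K ℍ[K,a * c ^ 2,b * d ^ 2] := by
    rw [_root_.QuaternionAlgebra.finrank_eq_four, _root_.QuaternionAlgebra.finrank_eq_four]
  have hsurj : Function.Surjective φ :=
    (LinearMap.injective_iff_surjective_of_finrank_eq_finrank hdim (f := φ.toLinearMap)).mp hinj
  exact ⟨AlgEquiv.ofBijective φ ⟨hinj, hsurj⟩⟩

/-- **Integral models**: a quaternion algebra over a number field `K` is `K`-isomorphic to
`ℍ[K,a,b]` for some non-zero `a, b ∈ 𝓞 K` (diagonalise, `exists_algEquiv_quaternionAlgebra`,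
then clear denominators by rescaling the generators). [cite: VignerasLNM800, Ch. I §1] -/
theorem exists_algEquiv_quaternionAlgebra_integers {K : Type} [Field K] [NumberField K]
    {D : Type*} [Ring D] [Algebra K D] [IsQuaternionAlgebra K D] :
    ∃ a b : 𝓞 K, a ≠ 0 ∧ b ≠ 0 ∧
      Nonempty (D ≃ₐ[K] ℍ[K,algebraMap (𝓞 K) K a,algebraMap (𝓞 K) K b]) := by
  obtain ⟨a, b, ha, hb, ⟨e⟩⟩ := IsQuaternionAlgebra.exists_algEquiv_quaternionAlgebra (K := K) (D := D)
  have hinj := FaithfulSMul.algebraMap_injective (𝓞 K) K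
  obtain ⟨⟨c, hc⟩, a', ha'⟩ := IsLocalization.exists_integer_multiple (nonZeroDivisors (𝓞 K)) a
  obtain ⟨⟨d, hd⟩, b', hb'⟩ := IsLocalization.exists_integer_multiple (nonZeroDivisors (𝓞 K)) b
  have hc0 : c ≠ 0 := nonZeroDivisors.ne_zero hc
  have hd0 : d ≠ 0 := nonZeroDivisors.ne_zero hd
  have hcK : algebraMap (𝓞 K) K c ≠ 0 := (map_ne_zero_iff _ hinj).mpr hc0
  have hdK : algebraMap (𝓞 K) K d ≠ 0 := (map_ne_zero_iff _ hinj).mpr hd0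
  simp only [Algebra.smul_def] at ha' hb'
  refine ⟨a' * c, b' * d, ?_, ?_, ?_⟩
  · refine mul_ne_zero (fun h => ha ?_) hc0
    rw [h, map_zero, zero_eq_mul] at ha'
    exact ha'.resolve_left hcK
  · refine mul_ne_zero (fun h => hb ?_) hd0
    rw [h, map_zero, zero_eq_mul] at hb'
    exact hb'.resolve_left hdK
  · obtain ⟨e'⟩ := nonempty_algEquiv_of_eq_mul_sq ha hb hcK hdK
      (a₂ := algebraMap (𝓞 K) K (a' * c)) (b₂ := algebraMap (𝓞 K) K (b' * d))
      (by rw [map_mul, ha']; ring) (by rw [map_mul, hb']; ring)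
    exact ⟨e.trans e'⟩

end QuaternionAlgebra

end Literature.NumberTheory.Automorphic
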